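import Literature.Analysis.FluidPDE.IteratedDirectionalIBP
import Literature.Analysis.FluidPDE.JiaSverak2014BootstrapTools
import Literature.Analysis.FluidPDE.HolderFieldCalculus
import Literature.Analysis.FluidPDE.HeatDuhamelBack
import Literature.Analysis.FluidPDE.JiaSverak2014HolderRepresentative
import HarnessLib

/-!
# Jia–Šverák 2014, local higher regularity: the tested equation on a smooth time slice

Analysis/FluidPDE proofs file (theorems only; no definitions, no named facts), part of the proof
of the named fact `Literature.Analysis.FluidPDE.jia_sverak_2014_local_higher_regularity`
(`JiaSverak2014LocalRegularity.lean`; H. Jia, V. Šverák, Invent. Math. 196 (2014) =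
arXiv:1204.0529, §4 proof of Thm 4.1: the bound on `∂ₜ∂ₓ^α u` is read off the equation
`∂ₜu = Δu - div(u ⊗ u) - ∇p` once `u(t)` is known to be smooth in `x` with bounds). Fix a time
slice on which the velocity `u(τ)` agrees a.e. on a ball `B(x₀, ρ)` with a `C^{m+2,γ}` field `R`
(constant `𝒞`) and the gauged pressure `q = p(τ) - c(τ)` is integrable on `B(x₀, 7/24)` with
`∫|q| ≤ Pq` and solves `Δq = -∂ᵢ∂ⱼ(uᵢuⱼ)` very weakly there. Testing with the field
`Φ = Dᵐφ[W ∘ rev] eᵢ` built from a smooth `φ` supported in `B(x₀, ρ - 2d)`: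

* the pairing `∫ ⟪u(τ), Φ⟫` equals `(-1)ᵐ ∫ ⟪DᵐR[W], eᵢ⟫ φ` (`pairing_eq`), and
* the remainder `∫ (⟪u, DΦ u⟫ + ⟪u, ΔΦ⟫ + q div Φ)(τ)` is bounded by `Θ ∏‖Wₖ‖ ∫|φ|`
  (`remainder_bound`), `Θ = Θ(m, γ, ρ, d, 𝒞, Pq)`,

by integrating by parts all derivatives onto `R` (convective and viscous terms) and onto the weak
gradient of the pressure, which on the inner ball is the smooth function
`∇Λ[1_B q] + T⁰[f]` of the very weak Poisson theory (`PoissonVeryWeakInterior.lean`) with the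
smooth compactly supported source `f = χ · (-∂ₖ∂ⱼ(RⱼRₖ))`.

* `poisson_source` — the source `f` and the very weak Poisson equation of `q` on `B(x₀, ρ)`;
* `pairing_eq`, `remainder_bound` — the statements above.

## References

* H. Jia, V. Šverák, Invent. Math. 196 (2014) = arXiv:1204.0529, §4. Bib key `JiaSverak2014`.
* D. Gilbarg, N. S. Trudinger, *Elliptic PDE of Second Order* (2001), Lemmas 4.1–4.2, 4.4.
  Bib key `GilbargTrudinger2001`.
-/

noncomputable section

open MeasureTheory TopologicalSpace Set Function Filter Metric
open _root_.Topology
open scoped ENNReal NNReal RealInnerProductSpace Laplacian ContDiff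

namespace Literature.Analysis.FluidPDE

namespace JiaSverak2014

open IteratedIBP

-- nested operator types
set_option maxSynthPendingDepth 3

/-! ## Small calculus on `ℝ³` -/

/-- A continuous linear map on `ℝ³` evaluated through the standard basis. [folklore] -/
theorem clm_apply_eq_sum {X : Type*} [NormedAddCommGroup X] [NormedSpace ℝ X]
    (L : EuclideanSpace ℝ (Fin 3) →L[ℝ] X) (v : EuclideanSpace ℝ (Fin 3)) :
    L v = ∑ j, ⟪v, EuclideanSpace.basisFun (Fin 3) ℝ j⟫ • L (EuclideanSpace.basisFun (Fin 3) ℝ j) := by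
  conv_lhs => rw [eq_sum_inner_smul_basisFun v]
  simp only [map_sum, map_smul]

/-- A continuous bilinear form on `ℝ³` on the diagonal, through the standard basis. [folklore] -/
theorem bilin_apply_eq_sum (L : EuclideanSpace ℝ (Fin 3) →L[ℝ] EuclideanSpace ℝ (Fin 3) →L[ℝ] ℝ)
    (v : EuclideanSpace ℝ (Fin 3)) :
    L v v = ∑ j, ∑ k, ⟪v, EuclideanSpace.basisFun (Fin 3) ℝ j⟫ * ⟪v, EuclideanSpace.basisFun (Fin 3) ℝ k⟫ *
      L (EuclideanSpace.basisFun (Fin 3) ℝ j) (EuclideanSpace.basisFun (Fin 3) ℝ k) := by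
  rw [clm_apply_eq_sum L v, sum_apply]
  refine Finset.sum_congr rfl fun j _ => ?_
  rw [smul_apply, clm_apply_eq_sum (L (EuclideanSpace.basisFun (Fin 3) ℝ j)) v, Finset.smul_sum]
  refine Finset.sum_congr rfl fun k _ => ?_
  simp only [smul_eq_mul]; ring

/-- `D(φ e)(x)v = (Dφ(x)v) e` for a scalar `φ` and a constant vector `e`. [folklore] -/
theorem fderiv_smul_const_apply' {φ : EuclideanSpace ℝ (Fin 3) → ℝ} {x : EuclideanSpace ℝ (Fin 3)}
    (hφ : DifferentiableAt ℝ φ x) (e v : EuclideanSpace ℝ (Fin 3)) :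
    fderiv ℝ (fun y => φ y • e) x v = (fderiv ℝ φ x v) • e := by
  rw [(hφ.hasFDerivAt.smul_const e).fderiv, ContinuousLinearMap.smulRight_apply]

/-- Replacing the velocity slice by its smooth representative inside integrands supported in the
ball where they agree a.e. [folklore] -/
theorem integral_congr_offBall {X : Type*} [NormedAddCommGroup X] [NormedSpace ℝ X]
    {x₀ : EuclideanSpace ℝ (Fin 3)} {ρ : ℝ} {R uτ : EuclideanSpace ℝ (Fin 3) → EuclideanSpace ℝ (Fin 3)}
    (huR : ∀ᵐ x ∂(volume.restrict (ball x₀ ρ)), R x = uτ x)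
    (F : EuclideanSpace ℝ (Fin 3) → EuclideanSpace ℝ (Fin 3) → X)
    (hF : ∀ x, x ∉ ball x₀ ρ → ∀ v w, F x v = F x w) :
    ∫ x, F x (uτ x) = ∫ x, F x (R x) := by
  refine integral_congr_ae ?_
  filter_upwards [(ae_restrict_iff' measurableSet_ball).1 huR] with x hx
  by_cases h : x ∈ ball x₀ ρ
  · rw [hx h]
  · exact hF x h _ _

/-! ## The coordinates and products of the representative in the Hölder classes -/

/-- Coordinates `⟪R, e⟫` (`‖e‖ ≤ 1`) of a `C^{k,γ}` field are `C^{k,γ}` with the same constant. [folklore] -/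
theorem isHolderField_inner {k : ℕ} {γ 𝒞 : ℝ} {R : EuclideanSpace ℝ (Fin 3) → EuclideanSpace ℝ (Fin 3)}
    (hR : IsHolderField k γ 𝒞 R) {e : EuclideanSpace ℝ (Fin 3)} (he : ‖e‖ ≤ 1) :
    IsHolderField k γ 𝒞 fun y => ⟪R y, e⟫ := by
  have h := hR.clm_comp_left (innerSL ℝ e)
  have hn : ‖innerSL ℝ e‖ * 𝒞 ≤ 𝒞 := by
    rw [innerSL_apply_norm]
    calc ‖e‖ * 𝒞 ≤ 1 * 𝒞 := mul_le_mul_of_nonneg_right he hR.nonneg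
      _ = 𝒞 := one_mul _
  have h' : IsHolderField k γ 𝒞 fun y => innerSL ℝ e (R y) := h.mono_const hn
  refine ⟨?_, ?_, ?_⟩
  · simpa only [innerSL_apply_apply, real_inner_comm] using h'.contDiff
  · intro j hj x
    have := h'.norm_le j hj x
    simpa only [innerSL_apply_apply, real_inner_comm] using this
  · intro x y
    have := h'.holder x y
    simpa only [innerSL_apply_apply, real_inner_comm] using this

/-! ## The Poisson source of the gauged pressure on the slice -/

set_option maxHeartbeats 3200000 in
/-- **The very weak Poisson equation of the gauged pressure slice, with a smooth source.** For `m`,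
`0 < γ < 1`, `0 < ρ` there is `C_f ≥ 0` such that: if `R ∈ C^{m+2,γ}` (constant `𝒞`) agrees a.e.
on `B(x₀,ρ)` with `u(τ)`, `ρ ≤ 7/24`, and `∫ q Δψ = -∫ D²ψ(u(τ),u(τ))` for all test `ψ` on
`B(x₀, 7/24)`, then there is a continuous compactly supported `f ∈ C^{m,γ}` (constant `C_f 𝒞²`,
`f = -∂ₖ∂ⱼ(RⱼRₖ)` on `B̄(x₀,ρ)` times a fixed cut-off) with `∫_{B(x₀,ρ)} q Δψ = ∫ f ψ` for every
test `ψ` on `B(x₀, ρ)`. [cite: GilbargTrudinger2001, §4.1] -/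
theorem poisson_source (m : ℕ) {γ : ℝ} (hγ0 : 0 < γ) (hγ1 : γ < 1) {ρ : ℝ} (hρ0 : 0 < ρ) :
    ∃ Cf : ℝ, 0 ≤ Cf ∧ ∀ {x₀ : EuclideanSpace ℝ (Fin 3)} {R uτ : EuclideanSpace ℝ (Fin 3) → EuclideanSpace ℝ (Fin 3)}
      {qτ : EuclideanSpace ℝ (Fin 3) → ℝ} {𝒞 : ℝ},
      IsHolderField (m + 2) γ 𝒞 R → (∀ᵐ x ∂(volume.restrict (ball x₀ ρ)), R x = uτ x) → ρ ≤ 7 / 24 →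
      (∀ ψ : (EuclideanSpace ℝ (Fin 3)) → ℝ,
        FunctionSpaces.IsTestFunctionOn (⟨ball x₀ (7 / 24), isOpen_ball⟩ : Opens (EuclideanSpace ℝ (Fin 3))) ψ →
        ∫ x, qτ x * Δ ψ x = -∫ x, fderiv ℝ (fderiv ℝ ψ) x (uτ x) (uτ x)) →
      ∃ f : (EuclideanSpace ℝ (Fin 3)) → ℝ, Continuous f ∧ HasCompactSupport f ∧ IsHolderField m γ (Cf * 𝒞 ^ 2) f ∧
        ∀ ψ : (EuclideanSpace ℝ (Fin 3)) → ℝ,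
          FunctionSpaces.IsTestFunctionOn (⟨ball x₀ ρ, isOpen_ball⟩ : Opens (EuclideanSpace ℝ (Fin 3))) ψ →
          ∫ x in ball x₀ ρ, qτ x * Δ ψ x = ∫ x, f x * ψ x := by
  classical
  set b : OrthonormalBasis (Fin 3) ℝ (EuclideanSpace ℝ (Fin 3)) := EuclideanSpace.basisFun (Fin 3) ℝ with hb_def
  have hb1 : ∀ i, ‖b i‖ = 1 := fun i => b.orthonormal.1 i
  -- the universal cut-off at the origin
  set χ₀ : ContDiffBump (0 : EuclideanSpace ℝ (Fin 3)) := ⟨ρ, ρ + 1, hρ0, by linarith⟩ with hχ₀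
  have hχ₀s : ContDiff ℝ ∞ (χ₀ : EuclideanSpace ℝ (Fin 3) → ℝ) := χ₀.contDiff
  have hχ₀c : HasCompactSupport (χ₀ : EuclideanSpace ℝ (Fin 3) → ℝ) := χ₀.hasCompactSupport
  obtain ⟨Aχ, hAχ⟩ := exists_isHolderField_of_hasCompactSupport hχ₀s hχ₀c hγ0.le hγ1.le m
  have hAχ0 : 0 ≤ Aχ := hAχ.nonneg
  set Cf : ℝ := 2 ^ (m + 2) * Aχ * (9 * 2 ^ (m + 2 + 2)) with hCf
  refine ⟨Cf, by positivity, ?_⟩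
  intro x₀ R uτ qτ 𝒞 hR huR hρ hpoisson
  have h𝒞 : 0 ≤ 𝒞 := hR.nonneg
  -- coordinates and products
  have hRc : ∀ j, IsHolderField (m + 2) γ 𝒞 fun y => ⟪R y, b j⟫ := fun j => isHolderField_inner hR (hb1 j).le
  set P : Fin 3 → Fin 3 → (EuclideanSpace ℝ (Fin 3)) → ℝ := fun j k y => ⟪R y, b j⟫ * ⟪R y, b k⟫ with hP
  have hPH : ∀ j k, IsHolderField (m + 2) γ (2 ^ (m + 2 + 2) * 𝒞 * 𝒞) (P j k) := fun j k => by
    have h := (hRc j).smul (hRc k) hγ0.le hγ1.le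
    simpa only [hP, smul_eq_mul] using h
  -- second derivatives `∂ₖ∂ⱼ P j k`
  set D2 : Fin 3 → Fin 3 → (EuclideanSpace ℝ (Fin 3)) → ℝ := fun j k y =>
    fderiv ℝ (fun z => fderiv ℝ (P j k) z (b j)) y (b k) with hD2
  have hD2H : ∀ j k, IsHolderField m γ (2 ^ (m + 2 + 2) * 𝒞 * 𝒞) (D2 j k) := fun j k => by
    have h1 := (hPH j k).fderiv_apply (b j)
    rw [hb1, mul_one] at h1
    have h2 := h1.fderiv_apply (b k)
    rw [hb1, mul_one] at h2
    exact h2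
  set S : (EuclideanSpace ℝ (Fin 3)) → ℝ := fun y => -∑ j, ∑ k, D2 j k y with hS
  have hSH : IsHolderField m γ (9 * 2 ^ (m + 2 + 2) * 𝒞 * 𝒞) S := by
    have h1 : IsHolderField m γ (∑ _j : Fin 3, ∑ _k : Fin 3, 2 ^ (m + 2 + 2) * 𝒞 * 𝒞) (∑ j : Fin 3, ∑ k : Fin 3, D2 j k) :=
      IsHolderField.sum _ fun j _ => IsHolderField.sum _ fun k _ => hD2H j k
    have h2 := h1.neg
    have hfun : S = -∑ j : Fin 3, ∑ k : Fin 3, D2 j k := by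
      funext y; simp only [hS, Pi.neg_apply, Finset.sum_apply]
    rw [hfun]
    refine h2.mono_const (le_of_eq ?_)
    simp only [Finset.sum_const, Finset.card_univ, Fintype.card_fin, nsmul_eq_mul]
    push_cast; ring
  -- the cut-off at `x₀` and the source
  set χ : (EuclideanSpace ℝ (Fin 3)) → ℝ := fun y => χ₀ (y - x₀) with hχ
  have hχH : IsHolderField m γ Aχ χ := hAχ.comp_sub_right x₀
  have hχ1 : ∀ y ∈ closedBall x₀ ρ, χ y = 1 := fun y hy => by
    simp only [hχ]
    exact χ₀.one_of_mem_closedBall (by rwa [mem_closedBall, dist_zero_right, ← dist_eq_norm])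
  have hχc : Continuous χ := χ₀.continuous.comp (continuous_id.sub continuous_const)
  have hχcs : HasCompactSupport χ := by
    have h := hχ₀c.comp_homeomorph (Homeomorph.subRight x₀)
    exact h
  set f : (EuclideanSpace ℝ (Fin 3)) → ℝ := fun y => χ y * S y with hf
  have hfH : IsHolderField m γ (Cf * 𝒞 ^ 2) f := by
    have h := hχH.smul hSH hγ0.le hγ1.le
    simp only [smul_eq_mul] at h
    refine h.mono_const (le_of_eq ?_)
    rw [hCf]; ring
  have hSc : Continuous S := hSH.continuous
  have hfc : Continuous f := hχc.mul hSc
  have hfcs : HasCompactSupport f := hχcs.mul_right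
  refine ⟨f, hfc, hfcs, hfH, ?_⟩
  -- ## the identity
  intro ψ hψ
  have hψs : ContDiff ℝ ∞ ψ := hψ.contDiff
  have hψc : HasCompactSupport ψ := hψ.hasCompactSupport
  have hψsupp : tsupport ψ ⊆ ball x₀ ρ := hψ.tsupport_subset
  have hψ2 : ContDiff ℝ 2 ψ := hψs.of_le (by norm_cast)
  -- `Δψ`, `D²ψ` vanish off the support
  have hΔ0 : ∀ x, x ∉ ball x₀ ρ → Δ ψ x = 0 := fun x hx => laplacian_eq_zero_of_notMem_tsupport fun h => hx (hψsupp h)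
  have hD20 : ∀ x, x ∉ ball x₀ ρ → fderiv ℝ (fderiv ℝ ψ) x = 0 := fun x hx => by
    have h0 : ψ =ᶠ[𝓝 x] fun _ => (0 : ℝ) := notMem_tsupport_iff_eventuallyEq.1 fun h => hx (hψsupp h)
    have h1 : fderiv ℝ ψ =ᶠ[𝓝 x] fun _ => (0 : EuclideanSpace ℝ (Fin 3) →L[ℝ] ℝ) := by
      filter_upwards [eventually_eventuallyEq_nhds.2 h0] with y hy
      rw [hy.fderiv_eq, fderiv_fun_const]; rfl
    rw [h1.fderiv_eq, fderiv_fun_const]; rfl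
  -- left-hand side over the whole space, then the hypothesis
  have hψ' : FunctionSpaces.IsTestFunctionOn (⟨ball x₀ (7 / 24), isOpen_ball⟩ : Opens (EuclideanSpace ℝ (Fin 3))) ψ :=
    ⟨hψs, hψc, hψsupp.trans (ball_subset_ball hρ)⟩
  rw [setIntegral_eq_integral_of_forall_compl_eq_zero (fun x hx => by rw [hΔ0 x hx, mul_zero]), hpoisson ψ hψ']
  -- replace `u(τ)` by `R`
  rw [integral_congr_offBall huR (fun x v => fderiv ℝ (fderiv ℝ ψ) x v v) (fun x hx v w => by simp only [hD20 x hx]; rfl)]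
  -- expand in the basis
  have hjk : ∀ x (j k : Fin 3), fderiv ℝ (fun z => fderiv ℝ ψ z (b k)) x (b j) = fderiv ℝ (fderiv ℝ ψ) x (b j) (b k) := by
    intro x j k
    have hd : DifferentiableAt ℝ (fderiv ℝ ψ) x := ((hψ2.fderiv_right (m := 1) le_rfl).differentiable one_ne_zero) x
    rw [fderiv_clm_apply hd (differentiableAt_const _)]
    have h0 : fderiv ℝ (fun _ : EuclideanSpace ℝ (Fin 3) => b k) x = 0 := fderiv_const_apply (b k)
    rw [h0, ContinuousLinearMap.comp_zero, zero_add, ContinuousLinearMap.flip_apply]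
  have hexp : ∀ x, fderiv ℝ (fderiv ℝ ψ) x (R x) (R x) = ∑ j, ∑ k, P j k x * fderiv ℝ (fun z => fderiv ℝ ψ z (b k)) x (b j) := by
    intro x
    rw [bilin_apply_eq_sum]
    refine Finset.sum_congr rfl fun j _ => Finset.sum_congr rfl fun k _ => ?_
    rw [hjk x j k]
  simp_rw [hexp]
  -- integrability of the pieces (continuous with compact support)
  have hPc : ∀ j k, ContDiff ℝ 2 (P j k) := fun j k => (hPH j k).contDiff.of_le (by exact_mod_cast Nat.le_add_left 2 m)
  have hψk : ∀ k, ContDiff ℝ ∞ (fun z => fderiv ℝ ψ z (b k)) := fun k =>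
    (hψs.fderiv_right (by exact_mod_cast le_top)).clm_apply contDiff_const
  have hψkc : ∀ k, HasCompactSupport (fun z => fderiv ℝ ψ z (b k)) := fun k => hψc.fderiv_apply (𝕜 := ℝ) (b k)
  have hint : ∀ j k, Integrable (fun x => P j k x * fderiv ℝ (fun z => fderiv ℝ ψ z (b k)) x (b j)) := by
    intro j k
    refine ((hPc j k).continuous.mul (((hψk k).continuous_fderiv (by simp)).clm_apply continuous_const)).integrable_of_hasCompactSupport ?_
    exact ((hψkc k).fderiv_apply (𝕜 := ℝ) (b j)).mul_left
  rw [integral_finsetSum _ (fun j _ => integrable_finsetSum _ fun k _ => hint j k)]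
  simp_rw [integral_finsetSum _ (fun k _ => hint _ k)]
  -- two integrations by parts in each term
  have hibp : ∀ j k, ∫ x, P j k x * fderiv ℝ (fun z => fderiv ℝ ψ z (b k)) x (b j) = ∫ x, D2 j k x * ψ x := by
    intro j k
    have hP1 : ContDiff ℝ 1 (P j k) := (hPc j k).of_le (by norm_cast)
    rw [PoissonWeyl.integral_mul_fderiv_apply_eq_neg hP1 ((hψk k).of_le (by exact_mod_cast le_top)) (hψkc k) (b j)]
    have hPj : ContDiff ℝ 1 (fun z => fderiv ℝ (P j k) z (b j)) :=
      ((hPc j k).fderiv_right (m := 1) le_rfl).clm_apply contDiff_const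
    rw [PoissonWeyl.integral_mul_fderiv_apply_eq_neg hPj (hψs.of_le (by exact_mod_cast le_top)) hψc (b k)]
    simp only [hD2, neg_neg]
  simp_rw [hibp]
  -- collect
  have hD2c : ∀ j k, Continuous (D2 j k) := fun j k => (hD2H j k).continuous
  have hint2 : ∀ j k, Integrable (fun x => D2 j k x * ψ x) := fun j k =>
    ((hD2c j k).mul hψs.continuous).integrable_of_hasCompactSupport hψc.mul_left
  have e3 : ∑ j, ∑ k, ∫ x, D2 j k x * ψ x = ∫ x, ∑ j, ∑ k, D2 j k x * ψ x := by
    rw [integral_finsetSum _ (fun j _ => integrable_finsetSum _ (fun k _ => hint2 j k))]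
    refine Finset.sum_congr rfl fun j _ => ?_
    rw [integral_finsetSum _ (fun k _ => hint2 j k)]
  rw [e3, ← integral_neg]
  refine integral_congr_ae (Eventually.of_forall fun x => ?_)
  by_cases hx : x ∈ tsupport ψ
  · have hχx : χ x = 1 := hχ1 x (ball_subset_closedBall (hψsupp hx))
    simp only [hf, hS, hχx, one_mul, neg_mul, Finset.sum_mul]
  · simp only [image_eq_zero_of_notMem_tsupport hx, mul_zero, Finset.sum_const_zero, neg_zero]

/-! ## The scalar test functions `y ↦ Dᵐφ(y)[V]` -/

/-- `y ↦ Dᵐφ(y)[V]` is smooth for smooth `φ`. [folklore] -/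
theorem contDiff_iteratedFDeriv_apply_const {m : ℕ} {φ : (EuclideanSpace ℝ (Fin 3)) → ℝ} (hφ : ContDiff ℝ ∞ φ)
    (V : Fin m → EuclideanSpace ℝ (Fin 3)) : ContDiff ℝ ∞ fun y => iteratedFDeriv ℝ m φ y V := by
  have e1 : (fun y => iteratedFDeriv ℝ m φ y V) =
      (ContinuousMultilinearMap.apply ℝ (fun _ : Fin m => EuclideanSpace ℝ (Fin 3)) ℝ V) ∘ iteratedFDeriv ℝ m φ := by
    funext y; simp only [Function.comp_apply, ContinuousMultilinearMap.apply_apply]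
  rw [e1]
  exact (ContinuousMultilinearMap.apply ℝ (fun _ : Fin m => EuclideanSpace ℝ (Fin 3)) ℝ _).contDiff.comp
    (hφ.iteratedFDeriv_right (by exact_mod_cast le_top))

/-- `y ↦ Dᵐφ(y)[V]` is supported in the support of `φ`. [folklore] -/
theorem tsupport_iteratedFDeriv_apply_const_subset {m : ℕ} (φ : (EuclideanSpace ℝ (Fin 3)) → ℝ)
    (V : Fin m → EuclideanSpace ℝ (Fin 3)) : tsupport (fun y => iteratedFDeriv ℝ m φ y V) ⊆ tsupport φ := by
  have hsub : support (fun y => iteratedFDeriv ℝ m φ y V) ⊆ support (iteratedFDeriv ℝ m φ) := fun y hy h =>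
    hy (by simp only [h, zero_apply])
  exact (closure_mono hsub).trans (tsupport_iteratedFDeriv_subset (𝕜 := ℝ) (f := φ) m)

/-- `y ↦ Dᵐφ(y)[V]` has compact support if `φ` has. [folklore] -/
theorem hasCompactSupport_iteratedFDeriv_apply_const {m : ℕ} {φ : (EuclideanSpace ℝ (Fin 3)) → ℝ}
    (hφc : HasCompactSupport φ) (V : Fin m → EuclideanSpace ℝ (Fin 3)) :
    HasCompactSupport fun y => iteratedFDeriv ℝ m φ y V :=
  hφc.of_isClosed_subset isClosed_closure (tsupport_iteratedFDeriv_apply_const_subset φ V)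

/-! ## The pairing and the remainder on the slice -/

/-- **The pairing against `φ̃ eᵢ`, `φ̃ = Dᵐφ[W ∘ rev]`, on a smooth slice**:
`∫ ⟪u(τ), φ̃ eᵢ⟫ = (-1)ᵐ ∫ ⟪DᵐR[W], eᵢ⟫ φ`. [folklore] -/
theorem pairing_eq (m : ℕ) {x₀ : EuclideanSpace ℝ (Fin 3)} {ρ ρ' : ℝ} (hρ' : ρ' ≤ ρ)
    {R uτ : EuclideanSpace ℝ (Fin 3) → EuclideanSpace ℝ (Fin 3)} (hR : ContDiff ℝ m R)
    (huR : ∀ᵐ x ∂(volume.restrict (ball x₀ ρ)), R x = uτ x)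
    (i : Fin 3) (W : Fin m → EuclideanSpace ℝ (Fin 3)) {φ φt : (EuclideanSpace ℝ (Fin 3)) → ℝ}
    (hφ : ContDiff ℝ ∞ φ) (hφc : HasCompactSupport φ) (hφs : tsupport φ ⊆ ball x₀ ρ')
    (hφt : ∀ y, φt y = iteratedFDeriv ℝ m φ y (fun k => W (Fin.rev k))) :
    ∫ x, ⟪uτ x, φt x • EuclideanSpace.basisFun (Fin 3) ℝ i⟫ =
      (-1 : ℝ) ^ m * ∫ x, ⟪iteratedFDeriv ℝ m R x W, EuclideanSpace.basisFun (Fin 3) ℝ i⟫ * φ x := by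
  set e := EuclideanSpace.basisFun (Fin 3) ℝ i with he
  have hφt' : φt = fun y => iteratedFDeriv ℝ m φ y (fun k => W (Fin.rev k)) := funext hφt
  have hD0 : ∀ x, x ∉ ball x₀ ρ → iteratedFDeriv ℝ m φ x = 0 := fun x hx =>
    image_eq_zero_of_notMem_tsupport fun h => hx ((tsupport_iteratedFDeriv_subset m).trans (hφs.trans (ball_subset_ball hρ')) h)
  rw [integral_congr_offBall huR (fun x v => ⟪v, φt x • e⟫)
    (fun x hx v w => by simp [hφt, hD0 x hx])]
  have e1 : ∀ x, ⟪R x, φt x • e⟫ = ⟪R x, e⟫ * iteratedFDeriv ℝ m φ x (fun k => W (Fin.rev k)) := fun x => by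
    rw [inner_smul_right, mul_comm, hφt]
  simp_rw [e1]
  rw [integral_mul_iteratedFDeriv_apply_eq m (hR.inner (𝕜 := ℝ) contDiff_const) hφ hφc]
  congr 1
  refine integral_congr_ae (Eventually.of_forall fun x => ?_)
  have hrev : (fun i => (fun k => W (Fin.rev k)) (Fin.rev i)) = W := by funext k; simp only [Fin.rev_rev]
  simp only [hrev, iteratedFDeriv_inner_apply hR e x W]

set_option maxHeartbeats 6400000 in
/-- **The remainder of the tested equation on a smooth slice.** For `m`, `0 < γ < 1`, `0 < d`,
`4d ≤ ρ ≤ 7/24`, `𝒞, Pq ≥ 0` there is `Θ ≥ 0` such that: if `R ∈ C^{m+2,γ}` (constant `𝒞`) agrees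
a.e. on `B(x₀,ρ)` with the slice `u(τ)`, the gauged pressure slice `q` is integrable on
`B(x₀,7/24)` with `∫_{B(x₀,7/24)}|q| ≤ Pq` and `∫ q Δψ = -∫ D²ψ(u(τ),u(τ))` for all test `ψ` on
`B(x₀,7/24)`, then for every direction `eᵢ`, every `W` and every smooth `φ` supported in
`B(x₀, ρ - 2d)`, with `φ̃ = Dᵐφ[W∘rev]` and `Φ = φ̃ eᵢ`,
`|∫ (⟪u(τ), DΦ u(τ)⟫ + ⟪u(τ), ΔΦ⟫ + q div Φ)| ≤ Θ ∏‖Wₖ‖ ∫|φ|`.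
[cite: JiaSverak2014, §4 proof of Thm 4.1] [cite: GilbargTrudinger2001, Lemmas 4.1–4.2] -/
theorem remainder_bound (m : ℕ) {γ : ℝ} (hγ0 : 0 < γ) (hγ1 : γ < 1) {ρ d : ℝ} (hd : 0 < d)
    (hρd : 4 * d ≤ ρ) (hρ : ρ ≤ 7 / 24) {𝒞 Pq : ℝ} (h𝒞 : 0 ≤ 𝒞) (hPq : 0 ≤ Pq) :
    ∃ Θ : ℝ, 0 ≤ Θ ∧ ∀ {x₀ : EuclideanSpace ℝ (Fin 3)} {R uτ : EuclideanSpace ℝ (Fin 3) → EuclideanSpace ℝ (Fin 3)}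
      {qτ : EuclideanSpace ℝ (Fin 3) → ℝ},
      IsHolderField (m + 2) γ 𝒞 R → (∀ᵐ x ∂(volume.restrict (ball x₀ ρ)), R x = uτ x) →
      IntegrableOn qτ (ball x₀ (7 / 24)) volume → (∫ x in ball x₀ (7 / 24), ‖qτ x‖ ≤ Pq) →
      (∀ ψ : (EuclideanSpace ℝ (Fin 3)) → ℝ,
        FunctionSpaces.IsTestFunctionOn (⟨ball x₀ (7 / 24), isOpen_ball⟩ : Opens (EuclideanSpace ℝ (Fin 3))) ψ →
        ∫ x, qτ x * Δ ψ x = -∫ x, fderiv ℝ (fderiv ℝ ψ) x (uτ x) (uτ x)) →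
      ∀ (i : Fin 3) (W : Fin m → EuclideanSpace ℝ (Fin 3)) {φ φt : (EuclideanSpace ℝ (Fin 3)) → ℝ},
        ContDiff ℝ ∞ φ → tsupport φ ⊆ ball x₀ (ρ - 2 * d) →
        (∀ y, φt y = iteratedFDeriv ℝ m φ y (fun k => W (Fin.rev k))) →
        |∫ x, (⟪uτ x, fderiv ℝ (fun y => φt y • EuclideanSpace.basisFun (Fin 3) ℝ i) x (uτ x)⟫ +
              ⟪uτ x, Δ (fun y => φt y • EuclideanSpace.basisFun (Fin 3) ℝ i) x⟫ +
              qτ x * VectorCalculus.divergence (fun y => φt y • EuclideanSpace.basisFun (Fin 3) ℝ i) x)| ≤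
          Θ * (∏ k, ‖W k‖) * ∫ x, ‖φ x‖ := by
  classical
  set b : OrthonormalBasis (Fin 3) ℝ (EuclideanSpace ℝ (Fin 3)) := EuclideanSpace.basisFun (Fin 3) ℝ with hb_def
  have hb1 : ∀ i, ‖b i‖ = 1 := fun i => b.orthonormal.1 i
  have hρ0 : 0 < ρ := by linarith
  -- ## universal constants
  have h₀ : 0 < d / 2 := by positivity
  have h₁ : d / 2 < d := by linarith
  obtain ⟨𝓛, h𝓛⟩ := PoissonWeyl.exists_norm_iteratedFDeriv_newtonFarSmoothing_le h₀ h₁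
  obtain ⟨CN, hCN0, hCN⟩ := exists_newtonNear_level_bounds m hγ0 hγ1 h₀ h₁
  obtain ⟨Cf, hCf0, hsrc⟩ := poisson_source m hγ0 hγ1 hρ0
  set Mf : ℝ := Cf * 𝒞 ^ 2 with hMf
  have hMf0 : 0 ≤ Mf := by positivity
  set LΛ : ℝ := ∑ k ∈ Finset.range (m + 3), |𝓛 k| with hLΛ
  have hLΛ0 : 0 ≤ LΛ := Finset.sum_nonneg fun _ _ => abs_nonneg _
  have hLΛk : ∀ k ≤ m + 2, |𝓛 k| ≤ LΛ := fun k hk =>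
    Finset.single_le_sum (f := fun k => |𝓛 k|) (fun _ _ => abs_nonneg _) (Finset.mem_range.2 (by omega))
  set cP : ℝ := 2 ^ (m + 2 + 2) * 𝒞 * 𝒞 with hcP
  have hcP0 : 0 ≤ cP := by positivity
  set Θ : ℝ := (∑ _j : Fin 3, 2 * cP) + (∑ _k : Fin 3, 𝒞) + (2 * (LΛ * Pq) + 2 * (CN * Mf)) with hΘ
  have hΘ0 : 0 ≤ Θ := by positivity
  refine ⟨Θ, hΘ0, ?_⟩
  intro x₀ R uτ qτ hR huR hqI hqPq hpoisson i W φ φt hφ hφs hφt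
  set e := b i with he_def
  have he1 : ‖e‖ = 1 := hb1 i
  have hφt' : φt = fun y => iteratedFDeriv ℝ m φ y (fun k => W (Fin.rev k)) := funext hφt
  -- ## the test function `φ̃`
  have hφc : HasCompactSupport φ := HasCompactSupport.of_support_subset_isCompact (isCompact_closedBall x₀ (ρ - 2 * d))
    ((subset_tsupport φ).trans (hφs.trans ball_subset_closedBall))
  have hφts : ContDiff ℝ ∞ φt := by rw [hφt']; exact contDiff_iteratedFDeriv_apply_const hφ _
  have hφtc : HasCompactSupport φt := by rw [hφt']; exact hasCompactSupport_iteratedFDeriv_apply_const hφc _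
  have hφtsupp : tsupport φt ⊆ ball x₀ (ρ - 2 * d) := by
    rw [hφt']; exact (tsupport_iteratedFDeriv_apply_const_subset φ _).trans hφs
  have hφt2 : ContDiff ℝ 2 φt := hφts.of_le (by norm_cast)
  have hφt1 : ContDiff ℝ 1 φt := hφts.of_le (by norm_cast)
  have hφtd : Differentiable ℝ φt := hφts.differentiable (by simp)
  have hφtρ : tsupport φt ⊆ ball x₀ ρ := hφtsupp.trans (ball_subset_ball (by linarith))
  have hφt0 : ∀ x, x ∉ ball x₀ ρ → φt x = 0 := fun x hx => image_eq_zero_of_notMem_tsupport fun h => hx (hφtρ h)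
  have hDφt0 : ∀ x, x ∉ ball x₀ ρ → fderiv ℝ φt x = 0 := fun x hx => by
    have h0 : φt =ᶠ[𝓝 x] fun _ => (0 : ℝ) := notMem_tsupport_iff_eventuallyEq.1 fun h => hx (hφtρ h)
    rw [h0.fderiv_eq, fderiv_fun_const]; rfl
  have hΔφt0 : ∀ x, x ∉ ball x₀ ρ → Δ φt x = 0 := fun x hx => laplacian_eq_zero_of_notMem_tsupport fun h => hx (hφtρ h)
  have hDkc : ∀ v, ContDiff ℝ ∞ (fun y => fderiv ℝ φt y v) := fun v => (hφts.fderiv_right (by exact_mod_cast le_top)).clm_apply contDiff_const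
  have hDkcs : ∀ v, HasCompactSupport (fun y => fderiv ℝ φt y v) := fun v => hφtc.fderiv_apply (𝕜 := ℝ) v
  have hΔc : Continuous (Δ φt) := continuous_laplacian hφt2
  have hΔcs : HasCompactSupport (Δ φt) := hφtc.mono' fun x hx => by
    by_contra h; exact hx (laplacian_eq_zero_of_notMem_tsupport h)
  -- ## pointwise form of the three integrands, and `u(τ) ↦ R`
  have hA : ∀ x v, ⟪v, fderiv ℝ (fun y => φt y • e) x v⟫ = ∑ j, (⟪v, b j⟫ * ⟪v, e⟫) * fderiv ℝ φt x (b j) := by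
    intro x v
    rw [fderiv_smul_const_apply' (hφtd x), inner_smul_right, clm_apply_eq_sum (fderiv ℝ φt x) v]
    simp only [smul_eq_mul]
    rw [Finset.sum_mul]
    refine Finset.sum_congr rfl fun j _ => ?_
    ring
  have hB : ∀ x v, ⟪v, Δ (fun y => φt y • e) x⟫ = ⟪v, e⟫ * Δ φt x := by
    intro x v; rw [laplacian_smul_const hφt2, inner_smul_right, mul_comm]
  have hC : ∀ x, VectorCalculus.divergence (fun y => φt y • e) x = fderiv ℝ φt x e := fun x =>
    divergence_smul_const e (hφtd x)
  simp_rw [hA, hB, hC]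
  rw [integral_congr_offBall huR
    (fun x v => (∑ j, ⟪v, b j⟫ * ⟪v, e⟫ * fderiv ℝ φt x (b j)) + ⟪v, e⟫ * Δ φt x + qτ x * fderiv ℝ φt x e)
    (fun x hx v w => by simp only [hDφt0 x hx, hΔφt0 x hx, zero_apply, mul_zero, Finset.sum_const_zero])]
  -- ## the Hölder data on the slice
  have hRc : ∀ j, IsHolderField (m + 2) γ 𝒞 fun y => ⟪R y, b j⟫ := fun j => isHolderField_inner hR (hb1 j).le
  have hRe : IsHolderField (m + 2) γ 𝒞 fun y => ⟪R y, e⟫ := isHolderField_inner hR he1.le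
  set Pj : Fin 3 → (EuclideanSpace ℝ (Fin 3)) → ℝ := fun j y => ⟪R y, b j⟫ * ⟪R y, e⟫ with hPj
  have hPjH : ∀ j, IsHolderField (m + 2) γ cP (Pj j) := fun j => by
    have h := (hRc j).smul hRe hγ0.le hγ1.le
    simpa only [hPj, smul_eq_mul] using h
  have hPj1 : ∀ j, ContDiff ℝ 1 (Pj j) := fun j => (hPjH j).contDiff.of_le (by exact_mod_cast Nat.le_add_left 1 (m + 1))
  set DPj : Fin 3 → (EuclideanSpace ℝ (Fin 3)) → ℝ := fun j y => fderiv ℝ (Pj j) y (b j) with hDPj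
  have hDPjH : ∀ j, IsHolderField m γ (2 * cP) (DPj j) := fun j => by
    have h := (hPjH j).fderiv_apply (b j)
    rw [hb1, mul_one] at h
    exact h.of_succ hγ0.le hγ1.le
  set D2e : Fin 3 → (EuclideanSpace ℝ (Fin 3)) → ℝ := fun k y =>
    fderiv ℝ (fun z => fderiv ℝ (fun w => ⟪R w, e⟫) z (b k)) y (b k) with hD2e
  have hD2eH : ∀ k, IsHolderField m γ 𝒞 (D2e k) := fun k => by
    have h1 := hRe.fderiv_apply (b k)
    rw [hb1, mul_one] at h1
    have h2 := h1.fderiv_apply (b k)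
    rw [hb1, mul_one] at h2
    exact h2
  have hRe2 : ContDiff ℝ 2 (fun y => ⟪R y, e⟫) := hRe.contDiff.of_le (by exact_mod_cast Nat.le_add_left 2 m)
  have hΔe : ∀ y, Δ (fun w => ⟪R w, e⟫) y = ∑ k, D2e k y := fun y => laplacian_eq_sum_fderiv_fderiv_normed b hRe2 y
  -- ## the pressure: source, potentials, weak gradient
  obtain ⟨f, hfc, hfcs, hfH, hfpoisson⟩ := hsrc hR huR hρ hpoisson
  have hqρ : IntegrableOn qτ (ball x₀ ρ) volume := hqI.mono_set (ball_subset_ball hρ)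
  have hGint : Integrable ((ball x₀ ρ).indicator qτ) := hqρ.integrable_indicator measurableSet_ball
  have hGL1 : ∫ y, ‖(ball x₀ ρ).indicator qτ y‖ ≤ Pq := by
    calc ∫ y, ‖(ball x₀ ρ).indicator qτ y‖ = ∫ y in ball x₀ ρ, ‖qτ y‖ := by
          rw [← integral_indicator measurableSet_ball]
          refine integral_congr_ae (Eventually.of_forall fun y => ?_)
          by_cases hy : y ∈ ball x₀ ρ
          · simp only [indicator_of_mem hy]
          · simp only [indicator_of_notMem hy, norm_zero]
      _ ≤ ∫ y in ball x₀ (7 / 24), ‖qτ y‖ :=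
          setIntegral_mono_set hqI.norm (Eventually.of_forall fun _ => norm_nonneg _) (ball_subset_ball hρ).eventuallyLE
      _ ≤ Pq := hqPq
  set Λ : (EuclideanSpace ℝ (Fin 3)) → ℝ := newtonFarSmoothing (d / 2) d ((ball x₀ ρ).indicator qτ) with hΛdef
  have hΛs : ContDiff ℝ ∞ Λ := PoissonWeyl.contDiff_newtonFarSmoothing_of_integrable h₀ h₁ hGint
  have hΛb : ∀ k ≤ m + 2, ∀ x, ‖iteratedFDeriv ℝ k Λ x‖ ≤ LΛ * Pq := by
    intro k hk x
    calc ‖iteratedFDeriv ℝ k Λ x‖ ≤ 𝓛 k * ∫ y, ‖(ball x₀ ρ).indicator qτ y‖ := h𝓛 _ hGint k x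
      _ ≤ |𝓛 k| * ∫ y, ‖(ball x₀ ρ).indicator qτ y‖ :=
          mul_le_mul_of_nonneg_right (le_abs_self _) (integral_nonneg fun _ => norm_nonneg _)
      _ ≤ LΛ * Pq := mul_le_mul (hLΛk k hk) hGL1 (integral_nonneg fun _ => norm_nonneg _) hLΛ0
  set Λe : (EuclideanSpace ℝ (Fin 3)) → ℝ := fun y => fderiv ℝ Λ y e with hΛe
  have hΛeH : IsHolderField m γ (2 * (LΛ * Pq)) Λe := by
    have hck : IsCkBounded (m + 1) (LΛ * Pq) Λe := by
      refine ⟨(hΛs.fderiv_right (by exact_mod_cast le_top)).clm_apply contDiff_const, fun j hj x => ?_⟩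
      have hΛj : ContDiff ℝ (j + 1) Λ := hΛs.of_le (by exact_mod_cast le_top)
      calc ‖iteratedFDeriv ℝ j Λe x‖ ≤ ‖e‖ * ‖iteratedFDeriv ℝ (j + 1) Λ x‖ := norm_iteratedFDeriv_fderiv_apply_le hΛj e x
        _ ≤ 1 * (LΛ * Pq) := mul_le_mul he1.le (hΛb (j + 1) (by omega) x) (norm_nonneg _) zero_le_one
        _ = LΛ * Pq := one_mul _
    exact hck.isHolderField_of_succ hγ0.le hγ1.le
  set N : (EuclideanSpace ℝ (Fin 3)) → ℝ := newtonNearGradPotential (d / 2) d e f with hNdef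
  obtain ⟨hNs, hNb, -⟩ := hCN hMf0 hfH.contDiff hfH.norm_le hfH.holder e
  have hNH : IsHolderField m γ (2 * (CN * Mf)) N := by
    have hck : IsCkBounded (m + 1) (CN * Mf) N := ⟨hNs, fun j hj x => by
      calc ‖iteratedFDeriv ℝ j N x‖ ≤ CN * ‖e‖ * Mf := hNb j hj x
        _ = CN * Mf := by rw [he1, mul_one]⟩
    exact hck.isHolderField_of_succ hγ0.le hγ1.le
  -- ## the function `H` collecting everything, in the Hölder class with constant `Θ`
  set H : (EuclideanSpace ℝ (Fin 3)) → ℝ := (-∑ j : Fin 3, DPj j) + (∑ k : Fin 3, D2e k) - (Λe + N) with hH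
  have hHH : IsHolderField m γ Θ H := by
    have h1 : IsHolderField m γ (∑ _j : Fin 3, 2 * cP) (∑ j : Fin 3, DPj j) := IsHolderField.sum _ fun j _ => hDPjH j
    have h2 : IsHolderField m γ (∑ _k : Fin 3, 𝒞) (∑ k : Fin 3, D2e k) := IsHolderField.sum _ fun k _ => hD2eH k
    have h3 := (h1.neg.add h2).sub (hΛeH.add hNH)
    exact h3
  have hHm : ContDiff ℝ m H := hHH.contDiff
  have hHapply : ∀ x, H x = (-∑ j, DPj j x) + (∑ k, D2e k x) - (Λe x + N x) := fun x => by
    simp only [hH, Pi.sub_apply, Pi.add_apply, Pi.neg_apply, Finset.sum_apply]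
  -- ## the integral identity `∫ (...) = ∫ H φ̃`
  have IPj : ∀ j, Integrable (fun x => Pj j x * fderiv ℝ φt x (b j)) := fun j =>
    ((hPj1 j).continuous.mul (hDkc (b j)).continuous).integrable_of_hasCompactSupport (hDkcs (b j)).mul_left
  have IA : Integrable (fun x => ∑ j, ⟪R x, b j⟫ * ⟪R x, e⟫ * fderiv ℝ φt x (b j)) := by
    have : (fun x => ∑ j, ⟪R x, b j⟫ * ⟪R x, e⟫ * fderiv ℝ φt x (b j)) = fun x => ∑ j, Pj j x * fderiv ℝ φt x (b j) := rfl
    rw [this]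
    exact integrable_finsetSum _ fun j _ => IPj j
  have IB : Integrable (fun x => ⟪R x, e⟫ * Δ φt x) :=
    (hRe2.continuous.mul hΔc).integrable_of_hasCompactSupport hΔcs.mul_left
  have IC : Integrable (fun x => qτ x * fderiv ℝ φt x e) := by
    have hEq : (fun x => qτ x * fderiv ℝ φt x e) = fun x => fderiv ℝ φt x e * (ball x₀ ρ).indicator qτ x := by
      funext x
      by_cases hx : x ∈ ball x₀ ρ
      · rw [indicator_of_mem hx, mul_comm]
      · rw [hDφt0 x hx, zero_apply, mul_zero, zero_mul]
    rw [hEq]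
    obtain ⟨K, hK⟩ := (hDkc e).continuous.bounded_above_of_compact_support (hDkcs e)
    exact hGint.bdd_mul (hDkc e).continuous.aestronglyMeasurable (Eventually.of_forall hK)
  -- term A
  have hTA : ∫ x, ∑ j, ⟪R x, b j⟫ * ⟪R x, e⟫ * fderiv ℝ φt x (b j) = ∫ x, (-∑ j, DPj j x) * φt x := by
    have e1 : (fun x => ∑ j, ⟪R x, b j⟫ * ⟪R x, e⟫ * fderiv ℝ φt x (b j)) = fun x => ∑ j, Pj j x * fderiv ℝ φt x (b j) := rfl
    rw [e1, integral_finsetSum _ (fun j _ => IPj j)]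
    have e2 : ∀ j, ∫ x, Pj j x * fderiv ℝ φt x (b j) = -∫ x, DPj j x * φt x := fun j =>
      PoissonWeyl.integral_mul_fderiv_apply_eq_neg (hPj1 j) hφt1 hφtc (b j)
    simp_rw [e2]
    have IDφ : ∀ j, Integrable (fun x => DPj j x * φt x) := fun j =>
      ((hDPjH j).continuous.mul hφts.continuous).integrable_of_hasCompactSupport hφtc.mul_left
    rw [Finset.sum_neg_distrib, ← integral_finsetSum _ (fun j _ => IDφ j), ← integral_neg]
    refine integral_congr_ae (Eventually.of_forall fun x => ?_)
    simp only [Finset.sum_mul, neg_mul]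
  -- term B
  have hTB : ∫ x, ⟪R x, e⟫ * Δ φt x = ∫ x, (∑ k, D2e k x) * φt x := by
    have h := integral_mul_laplacian_comm hRe2 hφt2 hφtc
    -- `h : ∫ φ̃ Δ R_e = ∫ (Δφ̃) R_e`
    calc ∫ x, ⟪R x, e⟫ * Δ φt x = ∫ x, Δ φt x * ⟪R x, e⟫ := by congr 1 with x; ring
      _ = ∫ x, φt x * Δ (fun w => ⟪R w, e⟫) x := h.symm
      _ = ∫ x, (∑ k, D2e k x) * φt x := by congr 1 with x; rw [hΔe x]; ring
  -- term C
  have hξ : FunctionSpaces.IsTestFunctionOn (⟨ball x₀ (ρ - d), isOpen_ball⟩ : Opens (EuclideanSpace ℝ (Fin 3))) φt :=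
    ⟨hφts, hφtc, hφtsupp.trans (ball_subset_ball (by linarith))⟩
  have hTC : ∫ x, qτ x * fderiv ℝ φt x e = ∫ x, (-(Λe x + N x)) * φt x := by
    rw [PoissonWeyl.integral_mul_fderiv_apply_eq_of_veryWeakPoisson h₀ h₁ hqρ hfc hfcs hfpoisson hξ e, ← integral_neg]
    refine integral_congr_ae (Eventually.of_forall fun x => ?_)
    simp only [hΛe, hNdef, hΛdef, neg_mul]
  have hsum : ∫ x, ((∑ j, ⟪R x, b j⟫ * ⟪R x, e⟫ * fderiv ℝ φt x (b j)) + ⟪R x, e⟫ * Δ φt x + qτ x * fderiv ℝ φt x e) =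
      ∫ x, H x * φt x := by
    have IAB : Integrable (fun x => (∑ j, ⟪R x, b j⟫ * ⟪R x, e⟫ * fderiv ℝ φt x (b j)) + ⟪R x, e⟫ * Δ φt x) := IA.add IB
    rw [integral_add IAB IC, integral_add IA IB, hTA, hTB, hTC]
    have I1 : Integrable (fun x => (-∑ j, DPj j x) * φt x) :=
      ((continuous_finsetSum _ fun j _ => (hDPjH j).continuous).neg.mul hφts.continuous).integrable_of_hasCompactSupport hφtc.mul_left
    have I2 : Integrable (fun x => (∑ k, D2e k x) * φt x) :=
      ((continuous_finsetSum _ fun k _ => (hD2eH k).continuous).mul hφts.continuous).integrable_of_hasCompactSupport hφtc.mul_left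
    have I3 : Integrable (fun x => (-(Λe x + N x)) * φt x) :=
      ((hΛeH.continuous.add hNH.continuous).neg.mul hφts.continuous).integrable_of_hasCompactSupport hφtc.mul_left
    have I12 : Integrable (fun x => (-∑ j, DPj j x) * φt x + (∑ k, D2e k x) * φt x) := I1.add I2
    rw [← integral_add I1 I2, ← integral_add I12 I3]
    refine integral_congr_ae (Eventually.of_forall fun x => ?_)
    show (-∑ j, DPj j x) * φt x + (∑ k, D2e k x) * φt x + -(Λe x + N x) * φt x = H x * φt x
    rw [hHapply]; ring
  rw [hsum]
  -- ## move the `m` derivatives onto `H` and bound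
  simp_rw [hφt]
  rw [integral_mul_iteratedFDeriv_apply_eq m hHm hφ hφc]
  have hrev : (fun i => (fun k => W (Fin.rev k)) (Fin.rev i)) = W := by funext k; simp only [Fin.rev_rev]
  simp only [hrev]
  have hbdH : ∀ x, ‖iteratedFDeriv ℝ m H x W‖ ≤ Θ * ∏ k, ‖W k‖ := fun x =>
    (ContinuousMultilinearMap.le_opNorm _ _).trans (mul_le_mul_of_nonneg_right (hHH.norm_le m le_rfl x)
      (Finset.prod_nonneg fun _ _ => norm_nonneg _))
  have Iφ : Integrable (fun x => ‖φ x‖) := (hφ.continuous.integrable_of_hasCompactSupport hφc).norm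
  have hcontD : Continuous fun x => iteratedFDeriv ℝ m H x W := by
    exact (ContinuousMultilinearMap.apply ℝ (fun _ : Fin m => EuclideanSpace ℝ (Fin 3)) ℝ W).continuous.comp
      (hHm.continuous_iteratedFDeriv (by exact_mod_cast le_rfl))
  have IHφ : Integrable (fun x => iteratedFDeriv ℝ m H x W * φ x) :=
    (hcontD.mul hφ.continuous).integrable_of_hasCompactSupport hφc.mul_left
  rw [abs_mul, abs_pow, abs_neg, abs_one, one_pow, one_mul]
  calc |∫ x, iteratedFDeriv ℝ m H x W * φ x| ≤ ∫ x, |iteratedFDeriv ℝ m H x W * φ x| := abs_integral_le_integral_abs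
    _ ≤ ∫ x, Θ * (∏ k, ‖W k‖) * ‖φ x‖ := by
        refine integral_mono IHφ.abs (Iφ.const_mul _) fun x => ?_
        rw [abs_mul, ← Real.norm_eq_abs, ← Real.norm_eq_abs (φ x)]
        exact mul_le_mul_of_nonneg_right (hbdH x) (norm_nonneg _)
    _ = Θ * (∏ k, ‖W k‖) * ∫ x, ‖φ x‖ := integral_const_mul _ _

end JiaSverak2014

end Literature.Analysis.FluidPDE
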